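import Literature.NumberTheory.EllipticCurves.SzpiroSixFifthsProofs
import Literature.NumberTheory.EllipticCurves.SzpiroOfAbcProofs
import Literature.NumberTheory.DiophantineGeometry.MinimalDiscriminantNormProofs
import HarnessLib

/-!
# Global minimal Frey model of an abc triple, with the discriminant comparison

Stub `stub_freyModelSqLe` of the line `SketchIdeator1` (card `szpiro-trace-port`, crux stmt-ABC-1723
`BalancedFreySzpiro`): every abc triple `(a, b, c)` carries a global minimal integral Frey model
`W₀` with conductor `N ∣ 2¹⁰ · rad(abc)` and `(abc)² ≤ 2⁸ |Δ(W₀)|`.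

This is Bombieri–Gubler Ex. 12.5.10 re-packaged with the DISCRIMINANT comparison (instead of the
`c₄` comparison):

* if `16 ∤ abc`, the model (12.17) `freyIntModel a b` (`y² = x³ + (b − a)x² − abx`) is globally
  minimal (`isMinimalAt_freyIntModel`) with `Δ = 16 (abc)²` (`freyIntModel_Δ`) and
  `N ∣ 2¹⁰ rad(abc)` (`conductorNorm_freyIntModel_dvd`);
* if `16 ∣ abc`, Serre's arrangement `(A, B)` of `{±a, ±b, ±c}` (`exists_arrangement`:
  `A ≡ −1 (mod 4)`, `16 ∣ B`, `|AB(A+B)| = abc`) and the model (12.18) `freyIntModel₂ A B` give a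
  globally minimal model (`isMinimalAt_freyIntModel₂`) with `2⁸ Δ = (abc)²` (`freyIntModel₂_Δ`) and
  `N ∣ rad(abc)` (`conductorNorm_freyIntModel₂_dvd`).

The line's assembly `BalancedFreySzpiro_of` reads Szpiro's `|Δ(W₀)| ≤ C · N^{6+ε}` for minimal
integral models (the neighbouring stub, not used here) on this `W₀` and uses `N ≤ 2¹⁰ · rad`.
-/

noncomputable section

-- `Summit.<Summit>.<Problem>` is the mandated summit-side namespace (CONVENTIONS §2); for the
-- single-conjunct summit `ABC` the two coincide, so the duplicate `ABC.ABC` is deliberate.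
set_option linter.dupNamespace false

namespace Summit.ABC.ABC.Theorems

open UniqueFactorizationMonoid IsDedekindDomain Real WeierstrassCurve Rat.HeightOneSpectrum
open Literature.NumberTheory.EllipticCurves Literature.NumberTheory.DiophantineGeometry

/-- Global minimal integral Frey model of an abc triple with conductor `∣ 2¹⁰ · rad(abc)` and
`(abc)² ≤ 2⁸ |Δ(W₀)|`; B–G (12.17): `Δ = 16 (abc)²` when `16 ∤ abc`, (12.18) after Serre's
arrangement: `2⁸ Δ = (abc)²`. [cite: BombieriGubler2006, Ex. 12.5.10] -/
theorem stub_freyModelSqLe : ∀ a b c : ℕ, IsABCTriple a b c →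
    ∃ W₀ : WeierstrassCurve ℤ, (W₀.baseChange ℚ).IsElliptic ∧
      (∀ v : HeightOneSpectrum ℤ, (W₀.baseChange ℚ).IsMinimalAt v) ∧
      (W₀.baseChange ℚ).conductorNorm ℤ ∣ 2 ^ 10 * rad a b c ∧
      ((a * b * c : ℕ) : ℤ) ^ 2 ≤ 2 ^ 8 * |W₀.Δ| := by
  intro a b c h
  have h' := h
  obtain ⟨ha, hb, habc, hcop⟩ := h'
  have hc : 0 < c := by omega
  have habc0 : a * b * c ≠ 0 := by positivity
  by_cases h16 : 16 ∣ a * b * c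
  · -- (12.18) on Serre's arrangement `(A, B)`: `2⁸ Δ = (AB(A+B))² = (abc)²`, `N ∣ rad(abc)`.
    obtain ⟨A, B, hAB, hA, hB, hprod, _hquad⟩ := exists_arrangement h h16
    have h0 : A * B * (A + B) ≠ 0 := by
      rw [← Int.natAbs_ne_zero, hprod]; exact habc0
    have h4 : 4 ∣ B - A - 1 := by
      have : B - A - 1 = B - (A + 1) := by ring
      rw [this]; exact dvd_sub (dvd_trans (by norm_num) hB) hA
    have h16' : 16 ∣ A * B := dvd_mul_of_dvd_right hB _
    refine ⟨freyIntModel₂ A B, isElliptic_freyIntModel₂ h0 h4 h16',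
      isMinimalAt_freyIntModel₂ hAB hA hB, ?_, ?_⟩
    · rw [rad_def, ← hprod]
      exact (conductorNorm_freyIntModel₂_dvd hAB h0 hA hB).trans (dvd_mul_left _ _)
    · rw [freyIntModel₂_Δ h4 h16']
      obtain ⟨e, he⟩ := h16'
      have he' : A * B / 16 = e := by rw [he]; simp
      have hcast : ((a * b * c : ℕ) : ℤ) ^ 2 = (A * B * (A + B)) ^ 2 := by
        rw [← hprod, Int.natCast_natAbs, sq_abs]
      rw [he', hcast, abs_of_nonneg (by positivity)]
      have : (A * B * (A + B)) ^ 2 = 2 ^ 8 * (e ^ 2 * (A + B) ^ 2) := by rw [he]; ring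
      rw [this]
  · -- (12.17) on `(a, b)`: `Δ = 16 (abc)²`, `N ∣ 2¹⁰ rad(abc)`.
    have hab : IsCoprime (a : ℤ) (b : ℤ) := Nat.isCoprime_iff_coprime.mpr hcop
    have hP : (a : ℤ) * b * (a + b) = ((a * b * c : ℕ) : ℤ) := by rw [← habc]; push_cast; ring
    have h0 : (a : ℤ) * b * (a + b) ≠ 0 := by rw [hP]; exact_mod_cast habc0
    have h16' : ¬ (16 : ℤ) ∣ (a : ℤ) * b * (a + b) := by
      rw [hP]; exact_mod_cast mt Int.natCast_dvd_natCast.mp h16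
    refine ⟨freyIntModel a b, isElliptic_freyIntModel h0, isMinimalAt_freyIntModel hab h0 h16',
      ?_, ?_⟩
    · have := conductorNorm_freyIntModel_dvd hab h0 h16'
      rwa [hP, Int.natAbs_natCast, ← rad_def] at this
    · rw [freyIntModel_Δ, hP, abs_of_nonneg (by positivity)]
      nlinarith [sq_nonneg (((a * b * c : ℕ) : ℤ))]

end Summit.ABC.ABC.Theorems

end
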